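import Summits.BirchSwinnertonDyer.Rank1Residual.Additive.TwistPartnerForcedCertificate
import HarnessLib

/-!
# The tame branch from boundedness of the forced partner ON THE `p`-POWER TOWER ONLY — the typed
# analytic input of defect 3, 4, 6 weakened to the values an instrument actually samples
# (cell `b2b-bsdres`, sub-cell additive-p2 = X3♯(G-ord) / X4♯(G-ord), gen 24; sequel of
# `TwistPartnerForcedCertificate.lean`)

HONEST FRAMING (cell `b2b-bsdres`, run/shared/lean/b2b/bsd-rank1-residual/, verbatim in every
file): the goal of the cell is to DELETE the COMBINATION-SHAPED residual classes of the
Birch–Swinnerton-Dyer formula for ALL analytic-rank `≤ 1` elliptic curves over `ℚ` — "full BSD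
formula for every rank `≤ 1` curve in class `C`" assembled STRICTLY from published theorems — so
that the rank-`≤ 1` remainder becomes exactly the CONSTRUCTION-SHAPED classes, which are TYPED
(missing-input `Prop`s), NOT attempted. This is not "finishing BSD". Sub-cell additive-p2: the
classes X3♯(G-ord) / X4♯(G-ord) are CONSTRUCTION-SHAPED and stay so; labels / RESIDUAL-MAP marks
UNCHANGED; nothing is booked. THEOREMS ONLY (no definition, no named fact, no conjecture node);
boundedness on the tower and every finite Riemann-sum statement are explicit hypotheses (referee-1
rule R1); instrument output is EVIDENCE for them, never a proof.

## What

Gen 23/24 produce the E-normalised tame branch `IsTameBranchOf f p (ι∘χ) ã B` (and its Riemann-sum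
truncation bound) from boundedness of the forced partner `Φ = forced χ [·]⁺_f ã` on ALL of `ℚ`
(`= CensusX43.HasOrdinaryTwistPartner χ f`, `hasOrdinaryTwistPartner_iff_bounded_forced`). But the
measure `μ(a + p^{n+1}ℤ_p) = ã^{−(n+1)}χ̄(a)Φ(a/p^{n+1})`, its bound and the integrality squeeze only
ever read `Φ` and `[·]⁺_f` on the `p`-POWER TOWER `{a/pⁿ : a ∈ ℤ, n ∈ ℕ}` — exactly the values the
census engines compute (gen 23 §3 "bounded m(n)", gen 24 E-FORCED-4/5/6); the distribution relation
and the interpolation rows need no bound at all. This file re-runs the bridge with TOWER hypotheses: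
* §1 `exists_towerSup_of_towerBounded` (a tower-bounded `Φ` attains its tower sup),
  `norm_twistPartnerMeasure_le_of_tower` (`‖μ‖ ≤` any tower bound), `norm_towerSup_le_of_twist_partner`
  (the squeeze: the tower sup of `Φ` is `≤` any TOWER bound `C` of `x = τ_{χ⁻¹}Φ`);
* §2 `exists_isTameBranchOf_riemannSum_of_twistPartnerData_tower` — the bridge WITH truncation bound
  from partner data bounded on the tower, the transfer and truncation constants being TOWER bounds of
  the plus symbols;
* §3 the FORCED partner: `exists_isTameBranchOf_riemannSum_of_towerBounded_forced` (`χ ≠ 1`,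
  `‖ã‖ = 1`, `U_p[·]⁺_f = 0`, `∀ n a, ‖Φ(a/pⁿ)‖ ≤ C₀`), the truncation bound for EVERY witness, and
  the certificate AT THE TOWER BOUND `p^c` of the plus symbols: `∀ n a, ‖[a/pⁿ]⁺_f‖ ≤ p^c`, `k < p`,
  `n ≥ 1`, `‖RS k n‖ = p^c ⟹ ‖[T^k]B‖ = p^c` (`c = 0`: the unit certificate).
So the typed analytic input of the defect-3/4/6 tame-branch route may be taken to be "the forced
partner is bounded on the `p`-power tower" — the statement about gen 23's numbers `m(n)`, for all
`n` — and the integrality input to be a tower bound of `E`'s own plus symbols. Nothing booked.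

References: B. Mazur, J. Tate, J. Teitelbaum, Invent. Math. 84 (1986) §I.10 (10.1), §I.11–I.14 (14.3)
[MazurTateTeitelbaum1986Invent]; W. Stein, C. Wuthrich, Math. Comp. 82 (2013) §3 [SteinWuthrich2013];
D. Delbourgo, Compositio Math. 113 (1998) §1.5 [Delbourgo1998].
-/

noncomputable section

open scoped Classical MatrixGroups ModularForm NumberField

open CongruenceSubgroup Literature.NumberTheory.EllipticCurves
  Literature.NumberTheory.EllipticCurves.ModularForms
  Literature.NumberTheory.EllipticCurves.Rank1Residual

namespace Summit.BirchSwinnertonDyer.Rank1Residual.Additive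

/-! ### §1 Tower sup, the measure bound and the squeeze, with tower hypotheses only -/

section Tower

variable {p : ℕ} [hp : Fact p.Prime]

/-- The denominator of `a/pⁿ` is a power of `p`. [folklore] -/
theorem exists_den_intCast_div_pow_eq (a : ℤ) (n : ℕ) :
    ∃ m : ℕ, ((a : ℚ) / (p : ℚ) ^ n).den = p ^ m := by
  have h1 : ((a : ℚ) / (p : ℚ) ^ n) = Rat.divInt a ((p : ℤ) ^ n) := by
    rw [Rat.divInt_eq_div]; push_cast; rfl
  have h2 : ((((a : ℚ) / (p : ℚ) ^ n).den : ℤ)) ∣ (p : ℤ) ^ n := by rw [h1]; exact Rat.den_dvd a _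
  have h3 : ((a : ℚ) / (p : ℚ) ^ n).den ∣ p ^ n := by exact_mod_cast h2
  obtain ⟨m, -, hm⟩ := (Nat.dvd_prime_pow hp.out).mp h3
  exact ⟨m, hm⟩

omit hp in
/-- A rational whose denominator is a power of `p` is a tower point `a/pᵐ`. [folklore] -/
theorem eq_intCast_div_pow_of_den_eq {s : ℚ} {m : ℕ} (h : s.den = p ^ m) :
    s = (s.num : ℚ) / (p : ℚ) ^ m := by
  conv_lhs => rw [← Rat.num_div_den s, h]
  push_cast
  rfl

/-- **A tower-bounded `ℚ_p`-valued function attains its tower sup** (the non-zero norms on the tower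
are `p^{−v}`, `v ∈ ℤ` bounded below). [folklore] -/
theorem exists_towerSup_of_towerBounded {Φ : ℚ → ℚ_[p]} {C₀ : ℝ}
    (hC₀ : ∀ (n : ℕ) (a : ℤ), ‖Φ ((a : ℚ) / (p : ℚ) ^ n)‖ ≤ C₀) :
    ∃ (n₁ : ℕ) (a₁ : ℤ), ∀ (n : ℕ) (a : ℤ),
      ‖Φ ((a : ℚ) / (p : ℚ) ^ n)‖ ≤ ‖Φ ((a₁ : ℚ) / (p : ℚ) ^ n₁)‖ := by
  -- restrict `Φ` to the tower (zero elsewhere) and use the global lemma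
  set g : ℚ → ℚ_[p] := fun s ↦ if ∃ m : ℕ, s.den = p ^ m then Φ s else 0 with hg
  have hgt : ∀ (n : ℕ) (a : ℤ), g ((a : ℚ) / (p : ℚ) ^ n) = Φ ((a : ℚ) / (p : ℚ) ^ n) := by
    intro n a
    simp only [hg, if_pos (exists_den_intCast_div_pow_eq a n)]
  have hgb : ∀ s, ‖g s‖ ≤ max C₀ 0 := by
    intro s
    by_cases hs : ∃ m : ℕ, s.den = p ^ m
    · obtain ⟨m, hm⟩ := hs
      rw [eq_intCast_div_pow_of_den_eq hm, hgt]
      exact (hC₀ m s.num).trans (le_max_left _ _)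
    · simp only [hg, if_neg hs, norm_zero]
      exact le_max_right _ _
  obtain ⟨s₁, hs₁⟩ := TwistPartner.exists_forall_norm_le_norm_of_bounded hgb
  by_cases hs : ∃ m : ℕ, s₁.den = p ^ m
  · obtain ⟨m, hm⟩ := hs
    refine ⟨m, s₁.num, fun n a ↦ ?_⟩
    rw [← hgt, ← hgt, ← eq_intCast_div_pow_of_den_eq hm]
    exact hs₁ _
  · have h0 : g s₁ = 0 := by simp only [hg, if_neg hs]
    refine ⟨0, 0, fun n a ↦ ?_⟩
    have h := hs₁ ((a : ℚ) / (p : ℚ) ^ n)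
    rw [hgt, h0, norm_zero] at h
    exact h.trans (norm_nonneg _)

/-- **Bound of the measure from a TOWER bound**: if `‖Φ(a/pⁿ)‖ ≤ M` for all tower points and `‖ã‖ = 1`,
`x = τ_{χ⁻¹}Φ`, then `‖μ(a + pⁿℤ_p)‖ ≤ M` (`μ = twistPartnerMeasure χ Φ ã (x 0)`; level `0` reads `Φ` at
the tower points `c/p`). [folklore] -/
theorem norm_twistPartnerMeasure_le_of_tower (χ : MulChar (ZMod p) ℚ_[p]) {Φ x : ℚ → ℚ_[p]}
    {ã : ℚ_[p]} (hã : ‖ã‖ = 1)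
    (hx : ∀ s, x s = ∑ c : ZMod p, χ⁻¹ c * Φ (s + (c.val : ℚ) / p))
    {M : ℝ} (hM : ∀ (n : ℕ) (a : ℤ), ‖Φ ((a : ℚ) / (p : ℚ) ^ n)‖ ≤ M) (n : ℕ) (a : ZMod (p ^ n)) :
    ‖twistPartnerMeasure χ Φ ã (x 0) n a‖ ≤ M := by
  have hãi : ‖ã⁻¹‖ = 1 := by rw [norm_inv, hã, inv_one]
  have htower : ∀ c : ZMod p, ‖Φ (0 + (c.val : ℚ) / p)‖ ≤ M := fun c ↦ by
    have h := hM 1 (c.val : ℤ)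
    rwa [pow_one, Int.cast_natCast, ← zero_add ((c.val : ℚ) / p)] at h
  cases n with
  | zero =>
    rw [twistPartnerMeasure_zero, norm_mul, hãi, one_mul, hx 0]
    obtain ⟨b, hb⟩ := CensusX43.exists_norm_twist_le χ⁻¹ Φ 0
    exact hb.trans (htower b)
  | succ n =>
    rw [twistPartnerMeasure_succ, norm_mul, norm_mul, norm_pow, hãi, one_pow, one_mul]
    have h := hM (n + 1) (a.val : ℤ)
    rw [Int.cast_natCast] at h
    exact (mul_le_of_le_one_left (norm_nonneg _) (CensusX43.norm_apply_le_one χ⁻¹ _)).trans h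

/-- **The squeeze on the tower**: if `x = τ_{χ⁻¹}Φ` (`χ ≠ 1`, `Φ` `1`-periodic, `U_p`-eigen with a unit
eigenvalue `ã`), the tower sup of `Φ` is attained at `a₁/p^{n₁}`, and `‖x(a/pⁿ)‖ ≤ C` on the TOWER, then
`‖Φ(a₁/p^{n₁})‖ ≤ C`: the identity `τ_χ x (s₁/p) = −χ(−1) ã Φ(s₁) + p χ(−1) Φ(s₁/p)`
(`CensusX43.twist_twist_inv`) reads `x` at the tower points `(a₁ + b p^{n₁})/p^{n₁+1}` and `Φ` at
`a₁/p^{n₁+1}`, and its first term dominates. [folklore] -/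
theorem norm_towerSup_le_of_twist_partner (χ : MulChar (ZMod p) ℚ_[p]) (hχ : χ ≠ 1) {Φ x : ℚ → ℚ_[p]}
    {ã : ℚ_[p]} (hã : ‖ã‖ = 1) (hper : ∀ s, Φ (s + 1) = Φ s)
    (hx : ∀ s, x s = ∑ c : ZMod p, χ⁻¹ c * Φ (s + (c.val : ℚ) / p))
    (hU : ∀ s, ∑ d : ZMod p, Φ (s + (d.val : ℚ) / p) = ã * Φ (p * s))
    {n₁ : ℕ} {a₁ : ℤ}
    (hs₁ : ∀ (n : ℕ) (a : ℤ), ‖Φ ((a : ℚ) / (p : ℚ) ^ n)‖ ≤ ‖Φ ((a₁ : ℚ) / (p : ℚ) ^ n₁)‖)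
    {C : ℝ} (hC : ∀ (n : ℕ) (a : ℤ), ‖x ((a : ℚ) / (p : ℚ) ^ n)‖ ≤ C) :
    ‖Φ ((a₁ : ℚ) / (p : ℚ) ^ n₁)‖ ≤ C := by
  have hp0 : (p : ℚ) ≠ 0 := Nat.cast_ne_zero.mpr hp.out.ne_zero
  set s₁ : ℚ := (a₁ : ℚ) / (p : ℚ) ^ n₁ with hs₁def
  set M : ℝ := ‖Φ s₁‖ with hM
  -- the two tower points read by the identity
  have hdown : s₁ / p = ((a₁ : ℤ) : ℚ) / (p : ℚ) ^ (n₁ + 1) := by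
    rw [hs₁def, pow_succ]; field_simp
  have hside : ∀ b : ZMod p, s₁ / p + (b.val : ℚ) / p =
      (((a₁ + (b.val : ℤ) * (p : ℤ) ^ n₁ : ℤ)) : ℚ) / (p : ℚ) ^ (n₁ + 1) := by
    intro b
    rw [hs₁def, pow_succ]; push_cast; field_simp
  have hkey : ∑ b : ZMod p, χ b * x (s₁ / p + (b.val : ℚ) / p) =
      -χ (-1) * (ã * Φ s₁) + (p : ℚ_[p]) * χ (-1) * Φ (s₁ / p) := by
    have h := CensusX43.twist_twist_inv χ hχ hper (s₁ / p)
    rw [hU, mul_div_cancel₀ _ hp0] at h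
    simp_rw [hx]
    exact h
  have hle : ‖-χ (-1) * (ã * Φ s₁) + (p : ℚ_[p]) * χ (-1) * Φ (s₁ / p)‖ ≤ C := by
    rw [← hkey]
    obtain ⟨b, hb⟩ := CensusX43.exists_norm_twist_le χ x (s₁ / p)
    refine hb.trans ?_
    rw [hside b]
    exact hC _ _
  have hA : ‖-χ (-1) * (ã * Φ s₁)‖ = M := by
    rw [norm_mul, norm_neg, CensusX43.norm_apply_neg_one, one_mul, norm_mul, hã, one_mul]
  by_cases hM0 : M = 0
  · rw [hM0]
    exact (norm_nonneg _).trans (hC 0 0)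
  have hMpos : 0 < M := lt_of_le_of_ne (norm_nonneg _) (Ne.symm hM0)
  have hB : ‖(p : ℚ_[p]) * χ (-1) * Φ (s₁ / p)‖ < M := by
    rw [norm_mul, norm_mul, CensusX43.norm_apply_neg_one, mul_one]
    have hpn : ‖(p : ℚ_[p])‖ < 1 := Padic.norm_p_lt_one
    have hΦ : ‖Φ (s₁ / p)‖ ≤ M := by rw [hdown]; exact hs₁ _ _
    calc ‖(p : ℚ_[p])‖ * ‖Φ (s₁ / p)‖ ≤ ‖(p : ℚ_[p])‖ * M :=
          mul_le_mul_of_nonneg_left hΦ (norm_nonneg _)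
      _ < 1 * M := mul_lt_mul_of_pos_right hpn hMpos
      _ = M := one_mul M
  have hne : ‖-χ (-1) * (ã * Φ s₁)‖ ≠ ‖(p : ℚ_[p]) * χ (-1) * Φ (s₁ / p)‖ := by
    rw [hA]; exact (ne_of_gt hB)
  have hmax := IsUltrametricDist.norm_add_eq_max_of_norm_ne_norm hne
  rw [hA, max_eq_left hB.le] at hmax
  rw [← hmax]
  exact hle

end Tower

/-! ### §2 The bridge WITH truncation bound from partner data bounded on the tower -/

section Data

variable {p : ℕ} [hp : Fact p.Prime] {N : ℕ} {f : CuspForm (Gamma0 N) 2}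
  {χ : MulChar (ZMod p) ℚ_[p]} {Φ : ℚ → ℚ_[p]} {ã : ℚ_[p]} {RS : ℕ → ℕ → ℚ_[p]}
  (hRS : ∀ k n : ℕ, RS k n =
      ∑ᶠ ξ : rootsOfUnity (Literature.NumberTheory.EllipticCurves.torsionOrder p) ℤ_[p],
        ∑ s : ZMod (p ^ n),
        twistPartnerMeasure χ Φ ã ((ratPlusSymbol f 0 : ℚ) : ℚ_[p]) (n + cyclotomicExponent p)
            (PadicInt.toZModPow (n + cyclotomicExponent p) ((ξ : ℤ_[p]ˣ) : ℤ_[p]) *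
              (cyclotomicGenerator p : ZMod (p ^ (n + cyclotomicExponent p))) ^ s.val) *
          ((s.val.choose k : ℕ) : ℚ_[p]))

include hRS

/-- **The bridge WITH truncation bound, TOWER hypotheses.** Named partner data `(Φ, ã)` of `[·]⁺_f`
(`χ ≠ 1`, `‖ã‖ = 1`, `Φ` `1`-periodic, `[·]⁺_f = τ_{χ⁻¹}Φ`, `∑_dΦ(s + d/p) = ãΦ(ps)`) whose TOWER sup is
attained at `a₁/p^{n₁}`: the Mellin transform `B` of `χ̄·μ_Φ` satisfies `IsTameBranchOf f p (ι∘χ) ã B`,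
the transfer `(∀ n a, ‖[a/pⁿ]⁺_f‖ ≤ C) → ∀ j, ‖[Tʲ]B‖ ≤ C` and the truncation bound
`‖[T^k]B − RS k n‖ ≤ (C/‖k!‖_p)·p⁻ⁿ` for every TOWER bound `C` of the plus symbols.
[cite: MazurTateTeitelbaum1986Invent, §I.13–I.14 (14.3)] [cite: SteinWuthrich2013, §3] -/
theorem exists_isTameBranchOf_riemannSum_of_twistPartnerData_tower (hχ : χ ≠ 1) (hã : ‖ã‖ = 1)
    (hper : ∀ s, Φ (s + 1) = Φ s)
    (hx : ∀ s, ((ratPlusSymbol f s : ℚ) : ℚ_[p]) = CensusX43.twist χ⁻¹ Φ s)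
    (hU : ∀ s, ∑ d : ZMod p, Φ (s + (d.val : ℚ) / p) = ã * Φ (p * s))
    {n₁ : ℕ} {a₁ : ℤ}
    (hs₁ : ∀ (n : ℕ) (a : ℤ), ‖Φ ((a : ℚ) / (p : ℚ) ^ n)‖ ≤ ‖Φ ((a₁ : ℚ) / (p : ℚ) ^ n₁)‖) :
    ∃ B : PowerSeries ℚ_[p], IsTameBranchOf f p (χ.ringHomComp (algebraMap ℚ_[p] ℂ_[p])) ã B ∧
      (∀ C : ℝ, (∀ (n : ℕ) (a : ℤ), ‖((ratPlusSymbol f ((a : ℚ) / (p : ℚ) ^ n) : ℚ) : ℚ_[p])‖ ≤ C) →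
        ∀ j : ℕ, ‖PowerSeries.coeff j B‖ ≤ C) ∧
      ∀ C : ℝ, (∀ (n : ℕ) (a : ℤ), ‖((ratPlusSymbol f ((a : ℚ) / (p : ℚ) ^ n) : ℚ) : ℚ_[p])‖ ≤ C) →
        ∀ k n : ℕ, ‖PowerSeries.coeff k B - RS k n‖ ≤
          C / ‖((k.factorial : ℕ) : ℚ_[p])‖ * (p : ℝ) ^ (-n : ℤ) := by
  have hã0 : ã ≠ 0 := fun h0 ↦ by rw [h0, norm_zero] at hã; exact zero_ne_one hã
  set x : ℚ → ℚ_[p] := fun r ↦ ((ratPlusSymbol f r : ℚ) : ℚ_[p]) with hxdef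
  have hx' : ∀ s, x s = ∑ c : ZMod p, χ⁻¹ c * Φ (s + (c.val : ℚ) / p) := hx
  have hx0 : x 0 = ((ratPlusSymbol f 0 : ℚ) : ℚ_[p]) := rfl
  have hdist := twistPartnerMeasure_distribution χ hã0 hx' hU
  have hC := norm_twistPartnerMeasure_le_of_tower χ hã hx' hs₁
  rw [hx0] at hdist hC
  obtain ⟨L, hbd, h0, hint, hRSle⟩ := exists_powerSeries_of_bounded_distribution_riemannSum hRS hdist hC
  refine ⟨L, ⟨⟨_, hbd⟩, ?_, ?_⟩, ?_, ?_⟩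
  · -- the constant term `μ(ℤ_p^×) = ã⁻¹ [0]⁺_f`
    rw [h0]
    haveI : NeZero (p ^ 1) := ⟨pow_ne_zero _ hp.out.ne_zero⟩
    have h1 := sum_units_mul_of_distribution hdist (RingHom.id ℚ_[p]) (m := 1)
      (L := cyclotomicExponent p) le_rfl (Nat.pos_of_ne_zero (cyclotomicExponent_ne_zero p))
      (fun _ ↦ (1 : ℚ_[p]))
    simp only [RingHom.id_apply, mul_one] at h1
    rw [h1, sum_units_eq_sum_filter_isUnit (F := fun a : ZMod (p ^ 1) ↦
      twistPartnerMeasure χ Φ ã ((ratPlusSymbol f 0 : ℚ) : ℚ_[p]) 1 a)]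
    have hfil : Finset.univ.filter (fun a : ZMod (p ^ 1) ↦ IsUnit a) = Finset.univ.erase 0 := by
      ext a
      simp [isUnit_iff_ne_zero_level_one]
    rw [hfil, Finset.sum_erase_eq_sub (Finset.mem_univ _)]
    have hz : twistPartnerMeasure χ Φ ã ((ratPlusSymbol f 0 : ℚ) : ℚ_[p]) 1 0 = 0 := by
      rw [twistPartnerMeasure_succ, ZMod.val_zero, Nat.cast_zero, MulChar.map_zero, mul_zero,
        zero_mul]
    rw [hz, sub_zero]
    simp_rw [twistPartnerMeasure_succ, zero_add, pow_one ã⁻¹, mul_assoc]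
    rw [← Finset.mul_sum, sum_level_one_eq χ Φ, ← hx0, hx' 0]
  · -- the interpolation rows, `m ≥ 2`
    intro m hm κ hκ heven hord
    obtain ⟨m', rfl⟩ : ∃ m', m = m' + 1 := ⟨m - 1, by omega⟩
    have h' := hint m' κ heven hord
    rwa [sum_mul_twistPartnerMeasure_eq hm hχ hper hx' hκ] at h'
  · -- transfer from a TOWER bound of the plus symbols
    intro C hCx j
    exact (hbd j).trans (norm_towerSup_le_of_twist_partner χ hχ hã hper hx' hU hs₁ hCx)
  · -- truncation bound
    intro C hCx k n
    have hΦC := norm_towerSup_le_of_twist_partner χ hχ hã hper hx' hU hs₁ hCx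
    refine (hRSle k n).trans ?_
    have hp0 : (0 : ℝ) ≤ (p : ℝ) ^ (-n : ℤ) := zpow_nonneg (Nat.cast_nonneg p) _
    have hk0 : (0 : ℝ) ≤ ‖((k.factorial : ℕ) : ℚ_[p])‖ := norm_nonneg _
    exact mul_le_mul_of_nonneg_right (div_le_div_of_nonneg_right hΦC hk0) hp0

end Data

/-! ### §3 The FORCED partner, bounded on the tower -/

section Forced

variable {p : ℕ} [hp : Fact p.Prime] {N : ℕ} [NeZero N] {f : CuspForm (Gamma0 N) 2}
  {χ : MulChar (ZMod p) ℚ_[p]} {ã : ℚ_[p]} {RS : ℕ → ℕ → ℚ_[p]}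
  (hRS : ∀ k n : ℕ, RS k n =
      ∑ᶠ ξ : rootsOfUnity (Literature.NumberTheory.EllipticCurves.torsionOrder p) ℤ_[p],
        ∑ s : ZMod (p ^ n),
        twistPartnerMeasure χ
            (TwistPartner.forced χ (fun r ↦ ((ratPlusSymbol f r : ℚ) : ℚ_[p])) ã) ã
            ((ratPlusSymbol f 0 : ℚ) : ℚ_[p]) (n + cyclotomicExponent p)
            (PadicInt.toZModPow (n + cyclotomicExponent p) ((ξ : ℤ_[p]ˣ) : ℤ_[p]) *
              (cyclotomicGenerator p : ZMod (p ^ (n + cyclotomicExponent p))) ^ s.val) *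
          ((s.val.choose k : ℕ) : ℚ_[p]))

include hRS

/-- **The forced tame branch from TOWER boundedness.** `χ ≠ 1`, `‖ã‖ = 1`, `U_p[·]⁺_f = 0`, and the
forced partner bounded ON THE TOWER, `∀ n a, ‖Φ(a/pⁿ)‖ ≤ C₀` (gen 23's `m(n)` bounded below, for all
`n`): there is `B` with `IsTameBranchOf f p (ι∘χ) ã B`, the transfer and the truncation bound for
every TOWER bound of the plus symbols. [cite: MazurTateTeitelbaum1986Invent, §I.10 (10.1) and §I.14 (14.3)]
[cite: SteinWuthrich2013, §3] -/
theorem exists_isTameBranchOf_riemannSum_of_towerBounded_forced (hχ : χ ≠ 1) (hã : ‖ã‖ = 1)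
    (hU0 : ∀ s, ∑ d : ZMod p, ratPlusSymbol f (s + (d.val : ℚ) / p) = 0) {C₀ : ℝ}
    (hC₀ : ∀ (n : ℕ) (a : ℤ),
      ‖TwistPartner.forced χ (fun r ↦ ((ratPlusSymbol f r : ℚ) : ℚ_[p])) ã ((a : ℚ) / (p : ℚ) ^ n)‖ ≤ C₀) :
    ∃ B : PowerSeries ℚ_[p], IsTameBranchOf f p (χ.ringHomComp (algebraMap ℚ_[p] ℂ_[p])) ã B ∧
      (∀ C : ℝ, (∀ (n : ℕ) (a : ℤ), ‖((ratPlusSymbol f ((a : ℚ) / (p : ℚ) ^ n) : ℚ) : ℚ_[p])‖ ≤ C) →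
        ∀ j : ℕ, ‖PowerSeries.coeff j B‖ ≤ C) ∧
      ∀ C : ℝ, (∀ (n : ℕ) (a : ℤ), ‖((ratPlusSymbol f ((a : ℚ) / (p : ℚ) ^ n) : ℚ) : ℚ_[p])‖ ≤ C) →
        ∀ k n : ℕ, ‖PowerSeries.coeff k B - RS k n‖ ≤
          C / ‖((k.factorial : ℕ) : ℚ_[p])‖ * (p : ℝ) ^ (-n : ℤ) := by
  set x : ℚ → ℚ_[p] := fun r ↦ ((ratPlusSymbol f r : ℚ) : ℚ_[p]) with hxdef
  have hperx : ∀ s, x (s + 1) = x s := fun s ↦ by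
    simp only [hxdef]
    rw [show (s + 1 : ℚ) = s + ((1 : ℤ) : ℚ) by push_cast; rfl, ratPlusSymbol_add_intCast_eq]
  have hU0' : ∀ s, ∑ d : ZMod p, x (s + (d.val : ℚ) / p) = 0 := fun s ↦ by
    simp only [hxdef]
    exact_mod_cast congrArg (fun q : ℚ ↦ (q : ℚ_[p])) (hU0 s)
  obtain ⟨hper', hx', hU'⟩ := TwistPartner.forced_isPartner hχ hã hperx hU0'
  obtain ⟨n₁, a₁, hs₁⟩ := exists_towerSup_of_towerBounded hC₀
  exact exists_isTameBranchOf_riemannSum_of_twistPartnerData_tower hRS hχ hã hper' (fun s ↦ hx' s)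
    hU' hs₁

/-- **Truncation bound for EVERY witness (tower hypotheses).** [cite: SteinWuthrich2013, §3] -/
theorem IsTameBranchOf.norm_coeff_sub_forcedRiemannSum_le_tower (hχ : χ ≠ 1) (hã : ‖ã‖ = 1)
    (hU0 : ∀ s, ∑ d : ZMod p, ratPlusSymbol f (s + (d.val : ℚ) / p) = 0) {C₀ : ℝ}
    (hC₀ : ∀ (n : ℕ) (a : ℤ),
      ‖TwistPartner.forced χ (fun r ↦ ((ratPlusSymbol f r : ℚ) : ℚ_[p])) ã ((a : ℚ) / (p : ℚ) ^ n)‖ ≤ C₀)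
    {B : PowerSeries ℚ_[p]} (hB : IsTameBranchOf f p (χ.ringHomComp (algebraMap ℚ_[p] ℂ_[p])) ã B)
    {C : ℝ} (hCx : ∀ (n : ℕ) (a : ℤ), ‖((ratPlusSymbol f ((a : ℚ) / (p : ℚ) ^ n) : ℚ) : ℚ_[p])‖ ≤ C)
    (k n : ℕ) :
    ‖PowerSeries.coeff k B - RS k n‖ ≤ C / ‖((k.factorial : ℕ) : ℚ_[p])‖ * (p : ℝ) ^ (-n : ℤ) := by
  obtain ⟨B₀, hB₀, -, hRSle⟩ :=
    exists_isTameBranchOf_riemannSum_of_towerBounded_forced hRS hχ hã hU0 hC₀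
  rw [hB.unique hB₀]
  exact hRSle C hCx k n

/-- **CERTIFICATE AT THE TOWER BOUND `p^c`** (tower hypotheses throughout): `χ ≠ 1`, `‖ã‖ = 1`,
`U_p[·]⁺_f = 0`, the forced partner bounded on the tower, the plus symbols bounded by `p^c` ON THE
TOWER, `k < p`, `n ≥ 1`: `‖RS k n‖_p = p^c ⟹ ‖[T^k]B‖_p = p^c` for every witness `B` (`c = 0`: the
unit certificate `‖RS k n‖ = 1 ⟹ ‖[T^k]B‖ = 1`). [cite: SteinWuthrich2013, §3]
[cite: MazurTateTeitelbaum1986Invent, §I.11–I.14] -/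
theorem IsTameBranchOf.norm_coeff_eq_pow_of_forcedRiemannSum_tower (hχ : χ ≠ 1) (hã : ‖ã‖ = 1)
    (hU0 : ∀ s, ∑ d : ZMod p, ratPlusSymbol f (s + (d.val : ℚ) / p) = 0) {C₀ : ℝ}
    (hC₀ : ∀ (n : ℕ) (a : ℤ),
      ‖TwistPartner.forced χ (fun r ↦ ((ratPlusSymbol f r : ℚ) : ℚ_[p])) ã ((a : ℚ) / (p : ℚ) ^ n)‖ ≤ C₀)
    {B : PowerSeries ℚ_[p]} (hB : IsTameBranchOf f p (χ.ringHomComp (algebraMap ℚ_[p] ℂ_[p])) ã B)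
    {c : ℕ}
    (hc : ∀ (n : ℕ) (a : ℤ), ‖((ratPlusSymbol f ((a : ℚ) / (p : ℚ) ^ n) : ℚ) : ℚ_[p])‖ ≤ (p : ℝ) ^ c)
    {k n : ℕ} (hk : k < p) (hn : 1 ≤ n) (heq : ‖RS k n‖ = (p : ℝ) ^ c) :
    ‖PowerSeries.coeff k B‖ = (p : ℝ) ^ c := by
  have hp1 : (1 : ℝ) < p := by exact_mod_cast hp.out.one_lt
  have hpc : (0 : ℝ) < (p : ℝ) ^ c := pow_pos (by exact_mod_cast hp.out.pos) c
  have hfac : ‖((k.factorial : ℕ) : ℚ_[p])‖ = 1 := by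
    have hnd : ¬ (p : ℤ) ∣ (k.factorial : ℤ) := by
      intro h
      have h' : p ∣ k.factorial := by exact_mod_cast h
      exact (Nat.not_le.mpr hk) (hp.out.dvd_factorial.mp h')
    rw [← Int.cast_natCast]
    exact le_antisymm (Padic.norm_int_le_one _)
      (not_lt.mp fun h ↦ hnd (Padic.norm_intCast_lt_one_iff.mp h))
  have herr : ‖PowerSeries.coeff k B - RS k n‖ < ‖RS k n‖ := by
    refine (hB.norm_coeff_sub_forcedRiemannSum_le_tower hRS hχ hã hU0 hC₀ hc k n).trans_lt ?_
    rw [hfac, div_one, heq]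
    calc (p : ℝ) ^ c * (p : ℝ) ^ (-n : ℤ) < (p : ℝ) ^ c * (p : ℝ) ^ (0 : ℤ) :=
          mul_lt_mul_of_pos_left (zpow_lt_zpow_right₀ hp1 (by omega)) hpc
      _ = (p : ℝ) ^ c := by rw [zpow_zero, mul_one]
  have h := IsUltrametricDist.norm_add_eq_max_of_norm_ne_norm herr.ne
  rw [sub_add_cancel, max_eq_right herr.le] at h
  rw [h, heq]

end Forced

end Summit.BirchSwinnertonDyer.Rank1Residual.Additive

end
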